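import Literature.AlgebraicGeometry.Resolution.BlowupSNC
import Literature.AlgebraicGeometry.Resolution.BlowupSequencesRestrictMarked
import HarnessLib

/-!
# Boundaries along admissible sequences of blow-ups have simple normal crossings (data level)

Topic: `Literature/AlgebraicGeometry/Resolution`. The data-level form (`CentreSeq`,
`CentreSeq.transformMarked`, `CentreSeq.IsAdmissibleFor`; `BlowupSequences.lean`) of
`IsMultipleBlowup.hasSNC_boundary` (`BlowupSNC.lean`; Kollár 2007, Def. 3.25: the total transform
of the boundary along blow-ups whose centres have simple normal crossings with it is a simple
normal crossing divisor; BGMW 2011, Def. 3.1.3 (2), (4)): along a sequence of blow-ups that is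
admissible for a marked ideal `M` whose boundary has simple normal crossings, every transformed
boundary has simple normal crossings. This is what a construction of a `CentreSeq` needs, at each
step, about the boundary it has produced so far (the remaining condition of `HasSNCWith E_i C_i`
concerns the next centre `C_i` alone).

* `CentreSeq.IsAdmissibleFor.hasSNC_transformMarked_boundary` — PROVED by induction along the
  sequence (`HasSNCWith.hasSNC_transform` at each chosen blow-up `blowup.π C`, `blowup.isBlowup`).

## Sources

* J. Kollár, *Lectures on Resolution of Singularities* (2007), Def. 3.25. [Kollar2007]
* E. Bierstone, D. Grigoriev, P. Milman, J. Włodarczyk, arXiv:1206.3090, Def. 3.1.3.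
  [BierstoneGrigorievMilmanWlodarczyk2011]
-/

noncomputable section

open CategoryTheory AlgebraicGeometry

namespace Literature.AlgebraicGeometry.Resolution

universe u

namespace CentreSeq

/-- **Along a sequence of blow-ups admissible for `M`, all transformed boundaries have simple
normal crossings**, provided the boundary of `M` has: the boundary of `s.transformMarked M` has
simple normal crossings (each step transforms by `MarkedIdeal.transform` along the chosen
blow-up of a centre having simple normal crossings with the current boundary).
[cite: BierstoneGrigorievMilmanWlodarczyk2011, Def. 3.1.3 (2), (4)] -/
theorem IsAdmissibleFor.hasSNC_transformMarked_boundary :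
    ∀ {X : Scheme.{u}} [IsLocallyNoetherian X] (s : CentreSeq X) (M : MarkedIdeal X),
      s.IsAdmissibleFor M → HasSNC M.boundary → HasSNC (s.transformMarked M).boundary
  | _, _, nil _, M, _, h0 => h0
  | X, _, cons C rest, M, hadm, _ => by
    obtain ⟨-, hsnc, -, hrest⟩ := (isAdmissibleFor_cons C rest M).mp hadm
    haveI : IsLocallyNoetherian (blowup C) := isLocallyNoetherian_blowup C
    rw [transformMarked_cons]
    exact IsAdmissibleFor.hasSNC_transformMarked_boundary rest _ hrest
      (MarkedIdeal.hasSNC_transform_boundary M hsnc (blowup.isBlowup C))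

/-- Along a sequence of blow-ups admissible for `M` (with `E` having simple normal crossings),
every local ring of the final scheme is regular. [cite: Kollar2007, Def. 3.25] -/
theorem IsAdmissibleFor.isRegularLocalRing_stalk_top {X : Scheme.{u}} [IsLocallyNoetherian X]
    (s : CentreSeq X) (M : MarkedIdeal X) (hadm : s.IsAdmissibleFor M) (h0 : HasSNC M.boundary)
    (y : s.top) : IsRegularLocalRing (s.top.presheaf.stalk y) :=
  ((hadm.hasSNC_transformMarked_boundary s M h0) y).1

end CentreSeq

end Literature.AlgebraicGeometry.Resolution

end
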